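import Summits.QuantumFields.BalabanUV.Beta.FP.FineSplitJunctionWindows
import Summits.QuantumFields.BalabanUV.Beta.FP.MixLoopPowerCountingMassQuartic

/-!
# `BalabanUV.Beta.FP.FineSplitJunctionMajorant` — road «FP» for binder row D1, row KER-γ «THE JUNCTION», SOCKET (α0), ledger side F′:
# THE TWO-LEG MAJORANT CORE (`MixLoopPowerCountingMassQuartic.coarse_secondMoment_of_majorant` — THE J-CONTRACTION LEMMA — RE-KEYED: the
# reference leg `J₁` at the anchor `v₀` and the running leg `J₂` SEPARATE, the absolute value INSIDE the window sums) + ITS JUNCTION COROLLARIES in the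
# input shape of `FineSplitJunctionWindows.rem_of_windows` — the majorant twin of `FineSplitJunctionTwoLeg` (F) for the words whose pointwise shape is a
# JOINT majorant `κ(b,b′)` (the (MIX-4) pair mass, the (MIX-3) polynomial profile), gluon and ghost alike

HONEST DEPENDENCY (page 1, mandatory): continuum YM on T⁴ ⇐ BetaPertH ∧ nine spine estimates (0/9 proved); BetaPertH ⇐ (D1) ∧ (D4) ∧
CAP+tail; G-an2-4 gates asym, D1 and NE2/3/4.  HONEST FRAMING (cell contract, verbatim): «discharging `BetaPertH` makes Bałaban's UV
stability UNCONDITIONAL — a real constructive-QFT result; it is NOT the continuum limit and NOT the Clay problem.»  THIS MODULE is elementary [folklore]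
real analysis on `ℤ⁴`: the (MIX-4) file's proof of `coarse_secondMoment_of_majorant` (steps 1–2) re-keyed symbol for symbol with two legs, over the same
helpers BY NAME (`MixLoopPowerCountingMassQuartic.runningLeg_moment_le`, `weight_profile_le`; `MixLoopPowerCounting.supNorm_cast_nonneg`); and two by-name
compositions shaped exactly as `FineSplitJunctionTwoLeg.rem_window_of_twoLeg` ∕ `rem_of_twoLeg` (F, p251473), with `FineSplitJunctionWindows.rem_of_windows`.
R-FP-36 (a)(b) (journal l.27988): the two-leg absolute core is the junction's MIX engine of record and every piece owes only its POINTWISE majorant + letters;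
F serves the PRODUCT shape `M₁ b·M₂ b′·E₀·e^{−(2δ∕n)‖b′−b‖∞}`; THIS file serves the general majorant `κ(b,b′)` with the WINDOWED MAJORANT letter (Mκ) of the
quartic∕cubic∕Gamma one-leg engines (`coarse_mix4_secondMoment_le`, `windowedMajorant_mix3_le`, `windowedMajorant_mix1_le`).  No existing file is touched.
No `def`, no `def … : Prop`, nothing cited, nothing of the manuscripts under audit asserted, 0 sorry.  NOT the pointwise shape of any piece, NOT the (LEDGER),
NOT hsplit, NOT (ASYMP), NOT D1; 0∕4 row-D1 binders; NOT BetaPertH, NOT continuum, NOT Clay.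

ABSOLUTE RULE (cell charter, verbatim): «No internally-minted statement may enter as a cited fact. Every hypothesis is either kernel-proved in this
package or a verbatim quotation of a PUBLISHED theorem with page reference. The manuscript(s) under audit are NOT citable for their own disputed
steps — they are the thing under adjudication; programme-internal (2001/route/tribunal) claims are never citable.»

CONTENT ([folklore]): §1 **`coarse_secondMoment_abs_of_majorant_twoLeg`** (the two-leg majorant core; letters (J)(J′)(hk)(Mκ) displayed); the one-leg
J-contraction lemma's conclusion is recovered from it (`example`); §2 **`rem_window_of_majorant`** (the windowed anchor-form bound of `rem_of_windows` FROM
per-`(c,e)` majorants of a matrix two-point piece, their (Mκ) letters at the anchor `0`, and the columns' (J)(J′) letters), **`rem_of_majorant`** (composed with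
`rem_of_windows`: the ledger line of (α0)).
Provenance: D1 formalisation swarm LEAF PROVER 05, unit `b2b-balaban-beta-d1-formalise-leaf-05` gen 15, 2026-08-21, road FP rows KER-γ (α0) ∕ (α2) sub-row α2-c
(the cubic∕quartic ghost words' supplier); «not in print; our bookkeeping».
-/

noncomputable section

namespace Summit.QuantumFields.BalabanUV.Beta.FP.FineSplitJunctionMajorant

open Finset Real Filter Topology
open scoped BigOperators
open Literature.MathematicalPhysics.QuantumFieldTheory.Balaban1983to89
open Literature.MathematicalPhysics.QuantumFieldTheory.Balaban1983to89.Beta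
open ExpKernelCalculus (Site MKer shiftK)
open OneStepResolventKernel (Fib)
open OneStepKernelFamily (colH)
open DyadicShell (Pt supNorm)
open Summit.QuantumFields.BalabanUV.Beta.D1BFx.MomentTransferPeriodic (IsBlockPeriodic)
open Summit.QuantumFields.BalabanUV.Beta.D1BFx.MomentTransferPeriodicEntry (EKer₂ dressedEntryP)
open Summit.QuantumFields.BalabanUV.Beta.FP.TransportInfinityM (colOf)
open Summit.QuantumFields.BalabanUV.Beta.FP.MixLoopPowerCounting (supNorm_cast_nonneg)
open Summit.QuantumFields.BalabanUV.Beta.FP.MixLoopPowerCountingMassQuartic (runningLeg_moment_le weight_profile_le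
  coarse_secondMoment_of_majorant)
open Summit.QuantumFields.BalabanUV.Beta.FP.FineSplitJunctionWindows (rem_of_windows)

/-! ## §1 The two-leg majorant core -/

section Core

variable {S V : Finset Pt} {v₀ : Pt} {J₁ : Pt → ℝ} {J₂ : Pt → Pt → ℝ} {k κ : Pt → Pt → ℝ}
  {C_J C_J' A_κ δ : ℝ} {n : ℕ}

/-- **THE TWO-LEG MAJORANT CORE (the J-contraction lemma with the legs separate and the absolute value inside)** [folklore] (`0 < δ`, `1 ≤ n`,
finite windows `S`, `V`, anchor `v₀`).  LETTERS: (hk) a nonnegative majorant `|k b b′| ≤ κ b b′`; (J) the reference leg `|J₁ b| ≤ C_J·e^{−(δ∕n)‖b − n•v₀‖∞}`;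
(J′) the running leg's coarse moments `Σ_{v∈V}(1 + (‖b′ − n•v‖∞∕n)²)·|J₂ b′ v| ≤ C_J′` for every `b′`; (Mκ) the WINDOWED MAJORANT letter
`Σ_{b∈S}Σ_{b′∈S} e^{−(δ∕(2n))‖b − n•v₀‖∞}·(1 + (‖b′ − b‖∞∕n)²)·κ b b′ ≤ A_κ`.  THEN
`Σ_{v∈V} ‖v − v₀‖∞²·Σ_{b∈S}Σ_{b′∈S} |J₁ b|·|J₂ b′ v|·|k b b′| ≤ 3·C_J·C_J′·(1 + 16∕δ²)·A_κ` — `coarse_secondMoment_of_majorant`, steps 1–2, with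
`runningLeg_moment_le` (running leg) and `weight_profile_le` (the reference leg absorbs the squares) BY NAME. -/
theorem coarse_secondMoment_abs_of_majorant_twoLeg (hδ : 0 < δ) (hn : 1 ≤ n)
    (hk : ∀ b b', |k b b'| ≤ κ b b')
    (hJ : ∀ b, |J₁ b| ≤ C_J * Real.exp (-(δ / n) * (supNorm (b - (n : ℤ) • v₀) : ℝ)))
    (hJ' : ∀ b', ∑ v ∈ V, (1 + ((supNorm (b' - (n : ℤ) • v) : ℝ) / n) ^ 2) * |J₂ b' v| ≤ C_J')
    (hMκ : ∑ b ∈ S, ∑ b' ∈ S, Real.exp (-(δ / (2 * n)) * (supNorm (b - (n : ℤ) • v₀) : ℝ)) *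
        (1 + ((supNorm (b' - b) : ℝ) / n) ^ 2) * κ b b' ≤ A_κ) :
    ∑ v ∈ V, (supNorm (v - v₀) : ℝ) ^ 2 * ∑ b ∈ S, ∑ b' ∈ S, |J₁ b| * |J₂ b' v| * |k b b'|
      ≤ 3 * C_J * C_J' * (1 + 16 / δ ^ 2) * A_κ := by
  have hCJ' : 0 ≤ C_J' := le_trans (Finset.sum_nonneg fun v _ => by positivity) (hJ' ((n : ℤ) • v₀))
  have hCJ : 0 ≤ C_J := by
    have h := hJ ((n : ℤ) • v₀)
    have e : Real.exp (-(δ / n) * (supNorm ((n : ℤ) • v₀ - (n : ℤ) • v₀) : ℝ)) = 1 := by simp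
    exact (abs_nonneg _).trans (by rw [e, mul_one] at h; exact h)
  have hκ0 : ∀ b b', 0 ≤ κ b b' := fun b b' => (abs_nonneg _).trans (hk b b')
  set Φ : Pt → Pt → ℝ := fun b b' => (((supNorm (b - (n : ℤ) • v₀) : ℝ) / n) ^ 2 + ((supNorm (b' - b) : ℝ) / n) ^ 2) + 1 with hΦ
  set E : Pt → ℝ := fun b => Real.exp (-(δ / (2 * n)) * (supNorm (b - (n : ℤ) • v₀) : ℝ)) with hE
  -- STEP 1: the majorant termwise, the sum over `v` innermost
  have step1 : ∀ v ∈ V, (supNorm (v - v₀) : ℝ) ^ 2 * ∑ b ∈ S, ∑ b' ∈ S, |J₁ b| * |J₂ b' v| * |k b b'|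
        ≤ ∑ b ∈ S, ∑ b' ∈ S, |J₁ b| * κ b b' * ((supNorm (v - v₀) : ℝ) ^ 2 * |J₂ b' v|) := by
    intro v _
    have h0 : 0 ≤ (supNorm (v - v₀) : ℝ) ^ 2 := by positivity
    calc _ ≤ (supNorm (v - v₀) : ℝ) ^ 2 * ∑ b ∈ S, ∑ b' ∈ S, |J₁ b| * |J₂ b' v| * κ b b' := by
          refine mul_le_mul_of_nonneg_left (Finset.sum_le_sum fun b _ => Finset.sum_le_sum fun b' _ => ?_) h0
          exact mul_le_mul_of_nonneg_left (hk b b') (by positivity)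
      _ = _ := by
          rw [Finset.mul_sum]
          refine Finset.sum_congr rfl fun b _ => ?_
          rw [Finset.mul_sum]
          exact Finset.sum_congr rfl fun b' _ => by ring
  -- STEP 2: swap `Σ_v` inside; the running leg's moment, then the reference leg absorbs the squares
  have step2 : ∀ b ∈ S, ∀ b' ∈ S, ∑ v ∈ V, |J₁ b| * κ b b' * ((supNorm (v - v₀) : ℝ) ^ 2 * |J₂ b' v|)
      ≤ (3 * C_J * C_J' * (1 + 16 / δ ^ 2)) * (E b * (1 + ((supNorm (b' - b) : ℝ) / n) ^ 2) * κ b b') := by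
    intro b _ b' _
    rw [← Finset.mul_sum]
    have h1 := runningLeg_moment_le (J := J₂) hn V v₀ b b' (hJ' b')
    have h2 := weight_profile_le (J := fun p _ => J₁ p) (v₀ := v₀) hδ hn (hJ b) b'
    calc |J₁ b| * κ b b' * ∑ v ∈ V, (supNorm (v - v₀) : ℝ) ^ 2 * |J₂ b' v|
        ≤ |J₁ b| * κ b b' * (3 * C_J' * Φ b b') := mul_le_mul_of_nonneg_left h1 (mul_nonneg (abs_nonneg _) (hκ0 b b'))
      _ = (3 * C_J' * κ b b') * (|J₁ b| * Φ b b') := by ring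
      _ ≤ (3 * C_J' * κ b b') * (C_J * (1 + 16 / δ ^ 2) * (1 + ((supNorm (b' - b) : ℝ) / n) ^ 2) * E b) :=
          mul_le_mul_of_nonneg_left h2 (by have := hκ0 b b'; positivity)
      _ = _ := by ring
  calc _ ≤ ∑ v ∈ V, ∑ b ∈ S, ∑ b' ∈ S, |J₁ b| * κ b b' * ((supNorm (v - v₀) : ℝ) ^ 2 * |J₂ b' v|) := Finset.sum_le_sum step1
    _ = ∑ b ∈ S, ∑ b' ∈ S, ∑ v ∈ V, |J₁ b| * κ b b' * ((supNorm (v - v₀) : ℝ) ^ 2 * |J₂ b' v|) := by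
        rw [Finset.sum_comm]; exact Finset.sum_congr rfl fun b _ => Finset.sum_comm
    _ ≤ ∑ b ∈ S, ∑ b' ∈ S, (3 * C_J * C_J' * (1 + 16 / δ ^ 2)) * (E b * (1 + ((supNorm (b' - b) : ℝ) / n) ^ 2) * κ b b') :=
        Finset.sum_le_sum fun b hb => Finset.sum_le_sum fun b' hb' => step2 b hb b' hb'
    _ = (3 * C_J * C_J' * (1 + 16 / δ ^ 2)) * ∑ b ∈ S, ∑ b' ∈ S, E b * (1 + ((supNorm (b' - b) : ℝ) / n) ^ 2) * κ b b' := by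
        rw [Finset.mul_sum]; exact Finset.sum_congr rfl fun b _ => by rw [Finset.mul_sum]
    _ ≤ (3 * C_J * C_J' * (1 + 16 / δ ^ 2)) * A_κ := mul_le_mul_of_nonneg_left hMκ (by positivity)
    _ = 3 * C_J * C_J' * (1 + 16 / δ ^ 2) * A_κ := by ring

/-- CONSISTENCY [folklore]: the one-leg J-contraction lemma's conclusion (`coarse_secondMoment_of_majorant`, ONE column family `J` at both anchors, the
absolute value OUTSIDE) follows from the two-leg core at `J₁ := J · v₀`, `J₂ := J` by the triangle inequality. -/
example {J : Pt → Pt → ℝ} (hδ : 0 < δ) (hn : 1 ≤ n)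
    (hk : ∀ b b', |k b b'| ≤ κ b b')
    (hJ : ∀ b, |J b v₀| ≤ C_J * Real.exp (-(δ / n) * (supNorm (b - (n : ℤ) • v₀) : ℝ)))
    (hJ' : ∀ b', ∑ v ∈ V, (1 + ((supNorm (b' - (n : ℤ) • v) : ℝ) / n) ^ 2) * |J b' v| ≤ C_J')
    (hMκ : ∑ b ∈ S, ∑ b' ∈ S, Real.exp (-(δ / (2 * n)) * (supNorm (b - (n : ℤ) • v₀) : ℝ)) *
        (1 + ((supNorm (b' - b) : ℝ) / n) ^ 2) * κ b b' ≤ A_κ) :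
    ∑ v ∈ V, (supNorm (v - v₀) : ℝ) ^ 2 * |∑ b ∈ S, ∑ b' ∈ S, J b v₀ * J b' v * k b b'|
      ≤ 3 * C_J * C_J' * (1 + 16 / δ ^ 2) * A_κ := by
  refine le_trans (Finset.sum_le_sum fun v _ => mul_le_mul_of_nonneg_left ?_ (by positivity))
    (coarse_secondMoment_abs_of_majorant_twoLeg (J₁ := fun b => J b v₀) (J₂ := J) hδ hn hk hJ hJ' hMκ)
  refine (Finset.abs_sum_le_sum_abs _ _).trans (Finset.sum_le_sum fun b _ =>
    (Finset.abs_sum_le_sum_abs _ _).trans (Finset.sum_le_sum fun b' _ => le_of_eq ?_))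
  rw [abs_mul, abs_mul]

end Core

/-! ## §2 The junction corollaries: the windowed anchor-form bound from per-`(c,e)` majorants -/

section Junction

variable {N : ℕ} {K : MKer (3 + 1) (Fib 3)} {G : EKer₂ 4} {a b : Fin 4}
  {κ : Fin 4 → Fin 4 → Pt → Pt → ℝ} {C_J C_J' Aκ δ : ℝ}

/-- **THE WINDOWED ANCHOR-FORM BOUND OF AN INDUCED PIECE FROM PER-(c,e) MAJORANTS** [folklore] (`0 < δ`, `1 ≤ N`): a matrix two-point piece `G` with, for
every fibre pair `(c, e)`, a majorant `|G c e p x| ≤ κ c e p x` carrying the WINDOWED MAJORANT letter at the anchor `0` on every fine window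
`Σ_{p∈A}Σ_{x∈A} e^{−(δ∕(2N))‖p − N•0‖∞}·(1 + (‖x − p‖∞∕N)²)·κ c e p x ≤ Aκ`, and columns of `K` with (J) `|colH K N a 0 c p| ≤ C_J·e^{−(δ∕N)‖p − N•0‖∞}` (anchor `0`,
every `c`) and (J′) `∀ x, Σ_{u∈S′}(1 + (‖x − N•u‖∞∕N)²)·|colH K N b u e x| ≤ C_J′` (every `e`, every finite coarse `S′`) ⟹ for every finite coarse `S′` and fine
window `A`: `Σ_{u∈S′}‖u‖∞²·|Σ_{c,e}Σ_{p∈A}Σ_{x∈A} colH K N a 0 c p·G c e p x·colH K N b u e x| ≤ 16·(3·C_J·C_J′·(1 + 16∕δ²)·Aκ)` — the input of `rem_of_windows`. -/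
theorem rem_window_of_majorant (hδ : 0 < δ) (hN : 1 ≤ N)
    (hG : ∀ (c e : Fin 4) (p x : Pt), |G c e p x| ≤ κ c e p x)
    (hAκ : ∀ (c e : Fin 4) (A : Finset Pt), ∑ p ∈ A, ∑ x ∈ A, Real.exp (-(δ / (2 * N)) * (supNorm (p - (N : ℤ) • (0 : Pt)) : ℝ)) *
        (1 + ((supNorm (x - p) : ℝ) / N) ^ 2) * κ c e p x ≤ Aκ)
    (hJ : ∀ (c : Fin 4) (p : Pt), |colH K N a 0 c p| ≤ C_J * Real.exp (-(δ / N) * (supNorm (p - (N : ℤ) • (0 : Pt)) : ℝ)))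
    (hJ' : ∀ (e : Fin 4) (S' : Finset Pt) (x : Pt), ∑ u ∈ S', (1 + ((supNorm (x - (N : ℤ) • u) : ℝ) / N) ^ 2) * |colH K N b u e x| ≤ C_J')
    (S' A : Finset Pt) :
    ∑ u ∈ S', (supNorm u : ℝ) ^ 2 * |∑ c, ∑ e, ∑ p ∈ A, ∑ x ∈ A, colH K N a 0 c p * G c e p x * colH K N b u e x|
      ≤ 16 * (3 * C_J * C_J' * (1 + 16 / δ ^ 2) * Aκ) := by
  -- per (c, e): the two-leg majorant core with `v₀ := 0`, `J₁ := colH … c`, `J₂ x u := colH K N b u e x`, `k := G c e`, `κ := κ c e`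
  have hce : ∀ c e : Fin 4, ∑ u ∈ S', (supNorm (u - 0) : ℝ) ^ 2 * ∑ p ∈ A, ∑ x ∈ A, |colH K N a 0 c p| * |colH K N b u e x| * |G c e p x|
      ≤ 3 * C_J * C_J' * (1 + 16 / δ ^ 2) * Aκ := fun c e =>
    coarse_secondMoment_abs_of_majorant_twoLeg (S := A) (V := S') (v₀ := 0) (J₁ := fun p => colH K N a 0 c p) (J₂ := fun x u => colH K N b u e x)
      (k := G c e) (κ := κ c e) hδ hN (hG c e) (hJ c) (hJ' e S') (hAκ c e A)
  -- triangle over (c, e) and reorder the factors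
  have htri : ∀ u ∈ S', (supNorm u : ℝ) ^ 2 * |∑ c, ∑ e, ∑ p ∈ A, ∑ x ∈ A, colH K N a 0 c p * G c e p x * colH K N b u e x|
      ≤ ∑ c, ∑ e, (supNorm (u - 0) : ℝ) ^ 2 * ∑ p ∈ A, ∑ x ∈ A, |colH K N a 0 c p| * |colH K N b u e x| * |G c e p x| := by
    intro u _
    have hin : |∑ c, ∑ e, ∑ p ∈ A, ∑ x ∈ A, colH K N a 0 c p * G c e p x * colH K N b u e x|
        ≤ ∑ c, ∑ e, ∑ p ∈ A, ∑ x ∈ A, |colH K N a 0 c p| * |colH K N b u e x| * |G c e p x| := by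
      refine (Finset.abs_sum_le_sum_abs _ _).trans (Finset.sum_le_sum fun c _ =>
        (Finset.abs_sum_le_sum_abs _ _).trans (Finset.sum_le_sum fun e _ =>
          (Finset.abs_sum_le_sum_abs _ _).trans (Finset.sum_le_sum fun p _ =>
            (Finset.abs_sum_le_sum_abs _ _).trans (Finset.sum_le_sum fun x _ => le_of_eq ?_))))
      rw [abs_mul, abs_mul]; ring
    calc (supNorm u : ℝ) ^ 2 * |∑ c, ∑ e, ∑ p ∈ A, ∑ x ∈ A, colH K N a 0 c p * G c e p x * colH K N b u e x|
        ≤ (supNorm u : ℝ) ^ 2 * ∑ c, ∑ e, ∑ p ∈ A, ∑ x ∈ A, |colH K N a 0 c p| * |colH K N b u e x| * |G c e p x| :=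
          mul_le_mul_of_nonneg_left hin (by positivity)
      _ = _ := by
          rw [sub_zero, Finset.mul_sum]
          exact Finset.sum_congr rfl fun c _ => Finset.mul_sum _ _ _
  calc ∑ u ∈ S', (supNorm u : ℝ) ^ 2 * |∑ c, ∑ e, ∑ p ∈ A, ∑ x ∈ A, colH K N a 0 c p * G c e p x * colH K N b u e x|
      ≤ ∑ u ∈ S', ∑ c, ∑ e, (supNorm (u - 0) : ℝ) ^ 2 * ∑ p ∈ A, ∑ x ∈ A, |colH K N a 0 c p| * |colH K N b u e x| * |G c e p x| :=
        Finset.sum_le_sum htri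
    _ = ∑ c, ∑ e, ∑ u ∈ S', (supNorm (u - 0) : ℝ) ^ 2 * ∑ p ∈ A, ∑ x ∈ A, |colH K N a 0 c p| * |colH K N b u e x| * |G c e p x| := by
        rw [Finset.sum_comm]
        exact Finset.sum_congr rfl fun c _ => Finset.sum_comm
    _ ≤ ∑ _c : Fin 4, ∑ _e : Fin 4, 3 * C_J * C_J' * (1 + 16 / δ ^ 2) * Aκ :=
        Finset.sum_le_sum fun c _ => Finset.sum_le_sum fun e _ => hce c e
    _ = 16 * (3 * C_J * C_J' * (1 + 16 / δ ^ 2) * Aκ) := by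
        rw [Finset.sum_const, Finset.sum_const, Finset.card_univ, Fintype.card_fin]
        simp only [nsmul_eq_mul]
        push_cast
        ring

/-- **THE LEDGER LINE OF (α0) FROM PER-(c,e) MAJORANTS** [folklore]: §2's windowed bound composed with `FineSplitJunctionWindows.rem_of_windows` — `K`
block-covariant with absolutely summable END columns, `G` bounded and block-periodic entrywise with per-`(c,e)` majorants and their windowed majorant letters,
columns with (J)(J′) ⟹ `∀ S′, Σ_{u∈S′}‖u‖∞²·|dressedEntryP (c a′ ↦ colH K N a′ 0 c) G (N•(−u)) a b| ≤ 16·(3·C_J·C_J′·(1 + 16∕δ²)·Aκ)`. -/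
theorem rem_of_majorant (hδ : 0 < δ) (hN : 1 ≤ N) (hKcov : ∀ t : Fin (3 + 1) → ℤ, shiftK (-((N : ℤ) • t)) K = K)
    (hcol : ∀ κ' l : Fin 4, Summable fun x => |colOf K κ' l x|)
    (hGper : ∀ c e, IsBlockPeriodic N (G c e)) (hGb : ∀ c e, ∃ A, ∀ s s', |G c e s s'| ≤ A)
    (hG : ∀ (c e : Fin 4) (p x : Pt), |G c e p x| ≤ κ c e p x)
    (hAκ : ∀ (c e : Fin 4) (A : Finset Pt), ∑ p ∈ A, ∑ x ∈ A, Real.exp (-(δ / (2 * N)) * (supNorm (p - (N : ℤ) • (0 : Pt)) : ℝ)) *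
        (1 + ((supNorm (x - p) : ℝ) / N) ^ 2) * κ c e p x ≤ Aκ)
    (hJ : ∀ (c : Fin 4) (p : Pt), |colH K N a 0 c p| ≤ C_J * Real.exp (-(δ / N) * (supNorm (p - (N : ℤ) • (0 : Pt)) : ℝ)))
    (hJ' : ∀ (e : Fin 4) (S' : Finset Pt) (x : Pt), ∑ u ∈ S', (1 + ((supNorm (x - (N : ℤ) • u) : ℝ) / N) ^ 2) * |colH K N b u e x| ≤ C_J') :
    ∀ S' : Finset Pt, ∑ u ∈ S', (supNorm u : ℝ) ^ 2 * |dressedEntryP (fun c a' => colH K N a' 0 c) G ((N : ℤ) • (-u)) a b|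
      ≤ 16 * (3 * C_J * C_J' * (1 + 16 / δ ^ 2) * Aκ) :=
  rem_of_windows hKcov hcol hGper hGb fun S' A => rem_window_of_majorant hδ hN hG hAκ hJ hJ' S' A

end Junction

end Summit.QuantumFields.BalabanUV.Beta.FP.FineSplitJunctionMajorant

end
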